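import Literature.NumberTheory.EllipticCurves.TwoDescentLocalI0
import HarnessLib

/-!
# Local conditions of the complete `2`-descent over `ℚ`, III: the `2`-adic condition for
# `y² = x³ - n²x` with `n = 2m`, `m` odd, and the square-free kernel for `χ₄`

Companion of `TwoDescentLocalTwo.lean` (residues modulo `8`, the characters `chi4`, `chi8`)
and `TwoDescentLocalI0.lean`. For the congruent number curve `E_n : y² = (x + n) x (x - n)` with
`n = 2m`, `m` odd, the `2`-Selmer conditions at `p = 2` are NOT consequences of the conditions at
the odd places; one of them, on rational points `(x, y)`, `y ≠ 0`, is the linear relation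

  `v₂(x + n) ≡ χ₄(x) + χ₄(m) · v₂(x) (mod 2)`   (`local_condition_two_cn`),

`χ₄(a) = 1` iff the odd part of `a` is `≡ 3 (mod 4)` (`chi4`). It is proved by the case analysis
on `v₂(x)` (`< 0`, `= 0`, `= 1`, `≥ 2`) with residues modulo `8` (`res8`, ultrametric rule
`res8_add_of_eq`), each case ending in a finite check on `(ℤ/8)^×` — the elementary content of
"`(b₁, b₂)` comes from `E(ℚ₂)`" in Silverman, *AEC*, Example X.1.5 (where the `2`-adic entries
of Table 10.1 are settled the same way). Also: the square-free kernel formula for `χ₄`,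
`chi4 r = signBit r · χ₄(-1) + Σ_q (v_q(r) mod 2) · χ₄(q)` (`chi4_eq_signBit_add_listSum`), which
makes the condition linear in the sign/parity coordinates of the descent, and evaluation of `chi4`
on integers. Everything is proved; no named facts.

## References

* J. H. Silverman, *The Arithmetic of Elliptic Curves*, 2nd ed., GTM 106 (2009), X.1
  Prop. 1.4 and Example 1.5 (pp. 270–272 of the held copy). [SilvermanAEC2009]
-/

noncomputable section

namespace Literature.NumberTheory.EllipticCurves.TwoDescentLocal

open Literature.NumberTheory.EllipticCurves.KramerTwoDescent

/-! ### `chi4`: evaluation and the square-free kernel -/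

section Chi4

/-- Powers of `2` do not change `chi4`. [folklore] -/
theorem chi4_two_zpow_mul (k : ℤ) (a : ℚ) : chi4 ((2 : ℚ) ^ k * a) = chi4 a := by
  by_cases ha : a = 0
  · rw [ha, mul_zero]
  rw [chi4, chi4, res8_two_zpow_mul k ha]

/-- `chi4` only depends on the odd part. [folklore] -/
theorem chi4_unitPart (a : ℚ) : chi4 (unitPart 2 a) = chi4 a := by
  by_cases ha : a = 0
  · simp [ha, unitPart]
  conv_rhs => rw [← zpow_mul_unitPart 2 a, show ((2 : ℕ) : ℚ) = 2 from rfl]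
  rw [chi4_two_zpow_mul]

/-- `chi4 (a²) = 0`. [folklore] -/
theorem chi4_sq (a : ℚ) : chi4 (a ^ 2) = 0 := by rw [sq, chi4_mul_self]

/-- `chi4 1 = 0`. [folklore] -/
theorem chi4_one : chi4 1 = 0 := by
  have h := chi4_mul_self 1
  rwa [mul_one] at h

/-- **`chi4` of an odd integer** is read off its class mod `8`. [folklore] -/
theorem chi4_intCast {z : ℤ} (hz : ¬ (2 : ℤ) ∣ z) : chi4 (z : ℚ) = chi4Of (z : ZMod (2 ^ 3)) := by
  rw [chi4, res8_intCast hz]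

/-- `chi4 (-1) = 1`. [folklore] -/
theorem chi4_neg_one : chi4 (-1) = 1 := by
  rw [show (-1 : ℚ) = ((-1 : ℤ) : ℚ) by norm_num, chi4_intCast (by decide)]
  decide

/-- Evaluation: `chi4 (2^k z)` for an odd integer `z ≡ 1 (mod 4)`. [folklore] -/
theorem chi4_eq_zero_of_eq {r : ℚ} (k : ℕ) (z : ℤ) (h : r = (2 : ℚ) ^ k * z) (hz : z % 4 = 1) :
    chi4 r = 0 := by
  have hodd : ¬ (2 : ℤ) ∣ z := by omega
  rw [h, ← zpow_natCast, chi4_two_zpow_mul, chi4_intCast hodd, chi4Of]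
  have h8 : z % 8 = 1 ∨ z % 8 = 5 := by omega
  have hcast : (z : ZMod (2 ^ 3)) = ((z % 8 : ℤ) : ZMod (2 ^ 3)) := by
    rw [show (2 : ℕ) ^ 3 = 8 from rfl]
    exact (ZMod.intCast_mod z 8).symm
  rw [hcast]
  rcases h8 with h8 | h8 <;> rw [h8] <;> decide

/-- Evaluation: `chi4 (2^k z)` for an odd integer `z ≡ 3 (mod 4)`. [folklore] -/
theorem chi4_eq_one_of_eq {r : ℚ} (k : ℕ) (z : ℤ) (h : r = (2 : ℚ) ^ k * z) (hz : z % 4 = 3) :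
    chi4 r = 1 := by
  have hodd : ¬ (2 : ℤ) ∣ z := by omega
  rw [h, ← zpow_natCast, chi4_two_zpow_mul, chi4_intCast hodd, chi4Of]
  have h8 : z % 8 = 3 ∨ z % 8 = 7 := by omega
  have hcast : (z : ZMod (2 ^ 3)) = ((z % 8 : ℤ) : ZMod (2 ^ 3)) := by
    rw [show (2 : ℕ) ^ 3 = 8 from rfl]
    exact (ZMod.intCast_mod z 8).symm
  rw [hcast]
  rcases h8 with h8 | h8 <;> rw [h8] <;> decide

/-- `chi4` of a product of non-zero naturals. [folklore] -/
theorem chi4_prod_natCast (S : Finset ℕ) (hS : ∀ q ∈ S, q ≠ 0) :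
    chi4 (∏ q ∈ S, (q : ℚ)) = ∑ q ∈ S, chi4 (q : ℚ) := by
  classical
  induction S using Finset.induction_on with
  | empty => simp [chi4_one]
  | insert a S ha ih =>
    have hS' : ∀ q ∈ S, q ≠ 0 := fun q hq => hS q (Finset.mem_insert_of_mem hq)
    have ha0 : (a : ℚ) ≠ 0 := Nat.cast_ne_zero.mpr (hS a (Finset.mem_insert_self a S))
    have hprod : (∏ q ∈ S, (q : ℚ)) ≠ 0 :=
      Finset.prod_ne_zero_iff.mpr fun q hq => Nat.cast_ne_zero.mpr (hS' q hq)
    rw [Finset.prod_insert ha, Finset.sum_insert ha, chi4_mul ha0 hprod, ih hS']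

/-- Positive case of the square-free kernel formula for `chi4`. [folklore] -/
theorem chi4_eq_sum_of_pos {w : ℚ} (hw : 0 < w) (T : Finset ℕ)
    (hT : ∀ q ∈ T, q.Prime) (heven : ∀ q : ℕ, q.Prime → q ∉ T → Even (padicValRat q w)) :
    chi4 w = ∑ q ∈ T, parityBit q w * chi4 (q : ℚ) := by
  classical
  set S := T.filter fun q => ¬ Even (padicValRat q w) with hSdef
  have hS : ∀ q ∈ S, q.Prime := fun q hq => hT q (Finset.mem_filter.mp hq).1
  have hkey : ∀ q : ℕ, q.Prime → (Even (padicValRat q w) ↔ q ∉ S) := by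
    intro q hq
    rw [hSdef, Finset.mem_filter, not_and, not_not]
    constructor
    · exact fun he _ => he
    · intro himp
      by_cases hqT : q ∈ T
      · exact himp hqT
      · exact heven q hq hqT
  obtain ⟨t, ht⟩ := exists_eq_prod_mul_sq hS hw hkey
  have hprod : (∏ q ∈ S, (q : ℚ)) ≠ 0 :=
    Finset.prod_ne_zero_iff.mpr fun q hq => Nat.cast_ne_zero.mpr (hS q hq).ne_zero
  have ht0 : t ≠ 0 := by
    rintro rfl
    rw [zero_pow two_ne_zero, mul_zero] at ht
    exact hw.ne' ht
  rw [ht, chi4_mul hprod (pow_ne_zero 2 ht0), chi4_sq, add_zero,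
    chi4_prod_natCast S fun q hq => (hS q hq).ne_zero, ← ht]
  have hSsub : S ⊆ T := Finset.filter_subset _ _
  rw [← Finset.sum_subset hSsub (f := fun q => parityBit q w * chi4 (q : ℚ)) ?_]
  · refine Finset.sum_congr rfl fun q hq => ?_
    have hodd : ¬ Even (padicValRat q w) := (Finset.mem_filter.mp hq).2
    rw [parityBit_eq_one_of_odd (Int.not_even_iff_odd.mp hodd), one_mul]
  · intro q hqT hqS
    have heven' : Even (padicValRat q w) := (hkey q (hT q hqT)).mpr hqS
    rw [parityBit_eq_zero_of_even heven', zero_mul]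

/-- **The square-free kernel formula for `χ₄`**: if the non-zero rational `r` has even
valuation at every ODD prime outside the finite set of primes `T ∌ 2`, then
`chi4 r = signBit r · chi4 (-1) + Σ_{q ∈ T} (v_q(r) mod 2) · chi4 q` — so the `2`-adic condition
`local_condition_two_cn` is linear in the sign and parity coordinates of the descent. [folklore] -/
theorem chi4_eq_signBit_add_sum {r : ℚ} (hr : r ≠ 0) (T : Finset ℕ) (hT : ∀ q ∈ T, q.Prime)
    (h2T : 2 ∉ T) (heven : ∀ q : ℕ, q.Prime → q ∉ T → q ≠ 2 → Even (padicValRat q r)) :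
    chi4 r = signBit r * chi4 (-1) + ∑ q ∈ T, parityBit q r * chi4 (q : ℚ) := by
  haveI : Fact (Nat.Prime 2) := ⟨Nat.prime_two⟩
  set u := unitPart 2 r with hu
  have hu0 : u ≠ 0 := unitPart_ne_zero 2 hr
  have hur : chi4 r = chi4 u := (chi4_unitPart r).symm
  have hsr : signBit r = signBit u := (signBit_unitPart (p := 2) r).symm
  have hpar : ∀ q ∈ T, parityBit q r = parityBit q u := by
    intro q hq
    haveI : Fact q.Prime := ⟨hT q hq⟩
    have hq2 : q ≠ 2 := fun h => h2T (h ▸ hq)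
    rw [parityBit, parityBit, hu, padicValRat_unitPart_of_ne hq2]
  have hevenu : ∀ q : ℕ, q.Prime → q ∉ T → Even (padicValRat q u) := by
    intro q hq hqT
    haveI : Fact q.Prime := ⟨hq⟩
    by_cases hq2 : q = 2
    · rw [hq2, hu, padicValRat_unitPart 2 hr]; exact ⟨0, rfl⟩
    · rw [hu, padicValRat_unitPart_of_ne hq2]; exact heven q hq hqT hq2
  rw [hur, hsr, Finset.sum_congr rfl fun q hq => by rw [hpar q hq]]
  rcases lt_or_gt_of_ne hu0 with hneg | hpos
  · have hw : 0 < -u := neg_pos.mpr hneg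
    have key := chi4_eq_sum_of_pos hw T hT fun q hq hqT => by
      rw [padicValRat.neg]; exact hevenu q hq hqT
    rw [show u = -1 * (-u) by ring, chi4_mul (by norm_num) hw.ne', key, signBit,
      if_pos (by linarith), one_mul]
    congr 1
    refine Finset.sum_congr rfl fun q _ => ?_
    rw [parityBit, parityBit, show -1 * -u = u by ring, padicValRat.neg]
  · have key := chi4_eq_sum_of_pos hpos T hT hevenu
    rw [key, signBit, if_neg (not_lt.mpr hpos.le), zero_mul, zero_add]

/-- List form of `chi4_eq_signBit_add_sum`. [folklore] -/
theorem chi4_eq_signBit_add_listSum {r : ℚ} (hr : r ≠ 0) (l : List ℕ) (hl : l.Nodup)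
    (hprime : ∀ q ∈ l, q.Prime) (h2l : 2 ∉ l)
    (heven : ∀ q : ℕ, q.Prime → q ∉ l → q ≠ 2 → Even (padicValRat q r)) :
    chi4 r = signBit r * chi4 (-1) + (l.map fun q => parityBit q r * chi4 (q : ℚ)).sum := by
  have key := chi4_eq_signBit_add_sum hr l.toFinset (fun q hq => hprime q (List.mem_toFinset.mp hq))
    (fun h => h2l (List.mem_toFinset.mp h))
    (fun q hq hql hq2 => heven q hq (fun h => hql (List.mem_toFinset.mpr h)) hq2)
  rw [key, List.sum_toFinset _ hl]

end Chi4

/-! ### The `2`-adic condition on `y² = (x + n) x (x - n)`, `n = 2m`, `m` odd -/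

section Two

/-- Finite checks on `(ℤ/8)^×` behind the four cases. [folklore] -/
theorem zmod8_cn_aux :
    (∀ r : ZMod (2 ^ 3), r * r = 1 → r * r * r = 1 → chi4Of r = 0) ∧
    (∀ r s : ZMod (2 ^ 3), r * r = 1 → s * s = 1 →
      (r + 2 * s) * r * (r + 2 * (((-1 : ℤ) : ZMod (2 ^ 3)) * s)) = 1 → chi4Of r = 0) ∧
    (∀ s e : ZMod (2 ^ 3), s * s = 1 →
      chi4Of (((-1 : ℤ) : ZMod (2 ^ 3)) * s + 4 * e) = 1 + chi4Of s) ∧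
    (∀ s e : ZMod (2 ^ 3), s * s = 1 → chi4Of (s + 4 * e) = chi4Of s) ∧
    (∀ r s : ZMod (2 ^ 3), r * r = 1 → s * s = 1 →
      (s + 2 * r) * r * (((-1 : ℤ) : ZMod (2 ^ 3)) * s + 2 * r) = 1 → chi4Of r = 1) ∧
    (∀ r s : ZMod (2 ^ 3), r * r = 1 → s * s = 1 →
      s * r * (((-1 : ℤ) : ZMod (2 ^ 3)) * s) = 1 → chi4Of r = 1) := by
  refine ⟨by decide, by decide, by decide, by decide, by decide, by decide⟩

/-- `chi4Of` on an odd integer class only depends on the class mod `4`: `chi4 m` for odd `m`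
is `chi4Of (res8 m)` with `res8 m = m mod 8`. [folklore] -/
theorem res8_intCast_odd {m : ℤ} (hm : Odd m) : res8 (m : ℚ) = (m : ZMod (2 ^ 3)) :=
  res8_intCast (by rcases hm with ⟨k, rfl⟩; omega)

/-- Powers of `2` in `ℤ/8`: `2^k = 4 · 2^(k-2)` for `k ≥ 2`. [folklore] -/
theorem two_pow_eq_four_mul {k : ℕ} (hk : 2 ≤ k) :
    (2 : ZMod (2 ^ 3)) ^ k = 4 * 2 ^ (k - 2) := by
  obtain ⟨j, rfl⟩ := Nat.exists_eq_add_of_le hk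
  rw [pow_add, Nat.add_sub_cancel_left]; rfl

/-- **The `2`-adic condition on `E_n : y² = (x + n) x (x - n)`, `n = 2m`, `m` odd.** For every
rational point `(x, y)` with `y ≠ 0`:
`v₂(x + n) ≡ χ₄(x) + χ₄(m) · v₂(x) (mod 2)`, i.e.
`parityBit 2 (x + n) = chi4 x + chi4 m · parityBit 2 x` — one of the three conditions
"`(b₁, b₂) ∈ δ(E(ℚ₂))`" at `p = 2`, in the elementary form of Silverman AEC Example X.1.5. Proof:
`v₂(x) < 0`: all three factors have the valuation of `x` and residue `res8 x`, whose cube is a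
square, so `res8 x = 1`; `v₂(x) = 0`: `res8 (x ± n) = res8 x ± 2 res8 m` and the product is a
square, forcing `res8 x = 5`; `v₂(x) = 1`: exactly one of `x ± n` has valuation `2`, the other odd
valuation `≥ 3`, and `res8 x ≡ ∓ res8 m (mod 4)`; `v₂(x) ≥ 2`: `v₂(x ± n) = 1` and the product
formula forces `res8 x ∈ {3, 7}`. [cite: SilvermanAEC2009, Example X.1.5] -/
theorem local_condition_two_cn {m : ℤ} (hm : Odd m) {n x y : ℚ} (hn : n = 2 * m)
    (h : y ^ 2 = (x - -n) * (x - 0) * (x - n)) (hy : y ≠ 0) :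
    parityBit 2 (x - -n) = chi4 (x - 0) + chi4 (m : ℚ) * parityBit 2 (x - 0) := by
  haveI : Fact (Nat.Prime 2) := ⟨Nat.prime_two⟩
  obtain ⟨hd₁, hd₂, hd₃⟩ := sub_ne_zero_of_sq_eq h hy
  rw [sub_zero] at hd₂ h ⊢
  have hm2 : ¬ (2 : ℤ) ∣ m := by rcases hm with ⟨k, rfl⟩; omega
  have hm0 : (m : ℚ) ≠ 0 := by exact_mod_cast (show m ≠ 0 by rintro rfl; exact hm2 ⟨0, rfl⟩)
  have hn0 : n ≠ 0 := by rw [hn]; exact mul_ne_zero two_ne_zero hm0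
  have hvm : padicValRat 2 (m : ℚ) = 0 := padicValRat_intCast_eq_zero (by exact_mod_cast hm2)
  have hvn : padicValRat 2 n = 1 := by
    rw [hn, padicValRat.mul two_ne_zero hm0, hvm, show (2 : ℚ) = ((2 : ℕ) : ℚ) from rfl,
      padicValRat.self one_lt_two]; rfl
  have hvnn : padicValRat 2 (-n) = 1 := by rw [padicValRat.neg, hvn]
  -- residues of the constants
  set s := res8 (m : ℚ) with hs
  have hss : s * s = 1 := res8_mul_self hm0
  have hrn : res8 n = s := by
    rw [hn, show (2 : ℚ) * m = (2 : ℚ) ^ (1 : ℤ) * m by ring, res8_two_zpow_mul 1 hm0]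
  have hrnn : res8 (-n) = ((-1 : ℤ) : ZMod (2 ^ 3)) * s := by
    rw [show -n = ((-1 : ℤ) : ℚ) * n by push_cast; ring, res8_mul (by norm_num) hn0, hrn,
      res8_intCast (by decide)]
  have hcm : chi4 (m : ℚ) = chi4Of s := rfl
  -- the product relation `res8 (x+n) · res8 x · res8 (x-n) = 1`
  set r := res8 x with hr
  have hrr : r * r = 1 := res8_mul_self hd₂
  have hprod : res8 (x - -n) * r * res8 (x - n) = 1 := by
    have h1 : res8 (y ^ 2) = res8 (x - -n) * r * res8 (x - n) := by
      rw [h, res8_mul (mul_ne_zero hd₁ hd₂) hd₃, res8_mul hd₁ hd₂]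
    rw [← h1, res8_sq, sq, res8_mul_self hy]
  have hsum := even_sum_padicValRat_of_sq (p := 2) h hd₁ hd₂ hd₃
  obtain ⟨aux_A, aux_B, aux_C1, aux_C2, aux_D1, aux_D2⟩ := zmod8_cn_aux
  have hx₁ : x - -n = x + n := by ring
  have hx₃ : x - n = x + -n := by ring
  set v := padicValRat 2 x with hv
  rcases lt_trichotomy v 0 with hneg | hzero | hpos
  · -- Case `v₂(x) < 0`
    have hv₁ : padicValRat 2 (x - -n) = v := by
      rw [hx₁]; exact (padicValRat_add_eq_left hd₂ (Or.inr (by rw [hvn]; omega))).2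
    have hv₃ : padicValRat 2 (x - n) = v := by
      rw [hx₃]; exact (padicValRat_add_eq_left hd₂ (Or.inr (by rw [hvnn]; omega))).2
    rw [hv₁, hv₃] at hsum
    have heven : Even v := by obtain ⟨k, hk⟩ := hsum; exact ⟨k - v, by omega⟩
    -- residues: `res8 (x ± n) = res8 x` (the perturbation has valuation `≥ v + 3`)
    obtain ⟨j, hj⟩ := heven
    obtain ⟨k, hk⟩ := Int.eq_ofNat_of_zero_le (show (0 : ℤ) ≤ 1 - v by omega)
    have hk3 : 3 ≤ k := by omega
    have hk1 : (1 : ℤ) = v + k := by omega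
    have h2k : (2 : ZMod (2 ^ 3)) ^ k = 0 := by
      obtain ⟨i, rfl⟩ := Nat.exists_eq_add_of_le hk3
      rw [pow_add, show (2 : ZMod (2 ^ 3)) ^ 3 = 0 from rfl, zero_mul]
    have hr₁ : res8 (x - -n) = r := by
      rw [hx₁, res8_add_of_eq hd₂ (k := k) (by omega) (by rw [hvn]; exact hk1), h2k, zero_mul,
        add_zero]
    have hr₃ : res8 (x - n) = r := by
      rw [hx₃, res8_add_of_eq hd₂ (k := k) (by omega) (by rw [hvnn]; exact hk1), h2k, zero_mul,
        add_zero]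
    have heven : Even v := ⟨j, hj⟩
    rw [hr₁, hr₃] at hprod
    rw [parityBit_eq_zero_of_even (by rw [hv₁]; exact heven), parityBit_eq_zero_of_even heven,
      mul_zero, add_zero, chi4, aux_A r hrr hprod]
  · -- Case `v₂(x) = 0`
    have hv₁ : padicValRat 2 (x - -n) = 0 := by
      rw [hx₁, ← hzero]; exact (padicValRat_add_eq_left hd₂ (Or.inr (by rw [hvn]; omega))).2
    have hr₁ : res8 (x - -n) = r + 2 * s := by
      rw [hx₁, res8_add_of_eq hd₂ le_rfl (by rw [hvn, ← hv, hzero]; rfl), hrn, pow_one]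
    have hr₃ : res8 (x - n) = r + 2 * (((-1 : ℤ) : ZMod (2 ^ 3)) * s) := by
      rw [hx₃, res8_add_of_eq hd₂ le_rfl (by rw [hvnn, ← hv, hzero]; rfl), hrnn, pow_one]
    rw [hr₁, hr₃] at hprod
    rw [parityBit_eq_zero_of_even (by rw [hv₁]; exact ⟨0, rfl⟩),
      parityBit_eq_zero_of_even (by rw [← hv, hzero]; exact ⟨0, rfl⟩), mul_zero, add_zero, chi4,
      aux_B r s hrr hss hprod]
  · by_cases hone : v = 1
    · -- Case `v₂(x) = 1`: one of `x ± n` has valuation `2`, the other odd valuation `≥ 3`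
      have hge₁ : (1 : ℤ) ≤ padicValRat 2 (x - -n) := by
        have := le_padicValRat_add_or (p := 2) (a := x) (b := n) (c := 1) (Or.inr (by omega))
          (Or.inr (by rw [hvn]))
        rw [hx₁]; exact this.resolve_left (by rw [← hx₁]; exact hd₁)
      have hge₃ : (1 : ℤ) ≤ padicValRat 2 (x - n) := by
        have := le_padicValRat_add_or (p := 2) (a := x) (b := -n) (c := 1) (Or.inr (by omega))
          (Or.inr (by rw [hvnn]))
        rw [hx₃]; exact this.resolve_left (by rw [← hx₃]; exact hd₃)
      rw [hone] at hsum
      -- `(x + n) - (x - n) = 2n` has valuation `2`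
      have h2n : (x - -n) + (-(x - n)) = (2 : ℚ) ^ (1 : ℤ) * n := by ring
      have hv2n : padicValRat 2 ((x - -n) + (-(x - n))) = 2 := by
        rw [h2n, padicValRat.mul (by norm_num) hn0, padicValRat.zpow,
          show (2 : ℚ) = ((2 : ℕ) : ℚ) from rfl, padicValRat.self one_lt_two, hvn]; rfl
      -- the two valuations are not equal (their sum is odd); the smaller one is `2`
      have hne : padicValRat 2 (x - -n) ≠ padicValRat 2 (x - n) := by
        intro heq; rw [heq] at hsum; obtain ⟨k, hk⟩ := hsum; omega
      rcases lt_or_gt_of_ne hne with hlt | hgt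
      · -- `v(x+n) < v(x-n)`: then `v(x+n) = 2`
        have hv₁ : padicValRat 2 (x - -n) = 2 := by
          rw [← hv2n]
          exact ((padicValRat_add_eq_left hd₁ (Or.inr (by rw [padicValRat.neg]; exact hlt))).2).symm
        have hodd₃ : Odd (padicValRat 2 (x - n)) := by
          obtain ⟨k, hk⟩ := hsum; exact ⟨k - 2, by omega⟩
        -- `x = n + (x - n)`, `v(x - n) = 1 + k`, `k ≥ 2`
        obtain ⟨k, hk, hk2⟩ : ∃ k : ℕ, padicValRat 2 (x - n) = padicValRat 2 n + k ∧ 2 ≤ k :=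
          ⟨(padicValRat 2 (x - n) - 1).toNat, by rw [hvn]; omega, by omega⟩
        have hrx : r = s + 4 * (2 ^ (k - 2) * res8 (x - n)) := by
          have hxe : res8 x = res8 (n + (x - n)) := by congr 1; ring
          rw [hr, hxe, res8_add_of_eq hn0 (k := k) (by omega) hk, hrn, two_pow_eq_four_mul hk2,
            mul_assoc]
        rw [parityBit_eq_zero_of_even (by rw [hv₁]; exact ⟨1, rfl⟩),
          parityBit_eq_one_of_odd (by rw [← hv, hone]; exact odd_one), mul_one, chi4, ← hr, hrx,
          aux_C2 s _ hss, ← hcm, ZModModule.add_self]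
      · -- `v(x-n) < v(x+n)`: then `v(x-n) = 2`
        have hv₃ : padicValRat 2 (x - n) = 2 := by
          have := (padicValRat_add_eq_left (p := 2) (neg_ne_zero.mpr hd₃) (b := x - -n)
            (Or.inr (by rw [padicValRat.neg]; exact hgt))).2
          rw [add_comm, padicValRat.neg] at this; rw [← hv2n]; exact this.symm
        have hodd₁ : Odd (padicValRat 2 (x - -n)) := by
          obtain ⟨k, hk⟩ := hsum; exact ⟨k - 2, by omega⟩
        obtain ⟨k, hk, hk2⟩ : ∃ k : ℕ, padicValRat 2 (x - -n) = padicValRat 2 (-n) + k ∧ 2 ≤ k :=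
          ⟨(padicValRat 2 (x - -n) - 1).toNat, by rw [hvnn]; omega, by omega⟩
        have hrx : r = ((-1 : ℤ) : ZMod (2 ^ 3)) * s + 4 * (2 ^ (k - 2) * res8 (x - -n)) := by
          have hxe : res8 x = res8 (-n + (x - -n)) := by congr 1; ring
          rw [hr, hxe, res8_add_of_eq (neg_ne_zero.mpr hn0) (k := k) (by omega) hk, hrnn,
            two_pow_eq_four_mul hk2, mul_assoc]
        rw [parityBit_eq_one_of_odd hodd₁,
          parityBit_eq_one_of_odd (by rw [← hv, hone]; exact odd_one), mul_one, chi4, ← hr, hrx,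
          aux_C1 s _ hss, ← hcm, add_assoc, ZModModule.add_self, add_zero]
    · -- Case `v₂(x) ≥ 2`
      have hv2 : (2 : ℤ) ≤ v := by omega
      have hv₁ : padicValRat 2 (x - -n) = 1 := by
        rw [hx₁, add_comm, ← hvn]
        exact (padicValRat_add_eq_left hn0 (Or.inr (by rw [hvn]; omega))).2
      have hv₃ : padicValRat 2 (x - n) = 1 := by
        rw [hx₃, add_comm, ← hvnn]
        exact (padicValRat_add_eq_left (neg_ne_zero.mpr hn0) (Or.inr (by rw [hvnn]; omega))).2
      rw [hv₁, hv₃] at hsum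
      have heven : Even v := by obtain ⟨k, hk⟩ := hsum; exact ⟨k - 1, by omega⟩
      obtain ⟨k, hk⟩ : ∃ k : ℕ, v = 1 + k ∧ 1 ≤ k := ⟨(v - 1).toNat, by omega, by omega⟩
      have hr₁ : res8 (x - -n) = s + 2 ^ k * r := by
        rw [hx₁, add_comm, res8_add_of_eq hn0 (k := k) hk.2 (by rw [hvn, ← hv]; exact_mod_cast hk.1),
          hrn]
      have hr₃ : res8 (x - n) = ((-1 : ℤ) : ZMod (2 ^ 3)) * s + 2 ^ k * r := by
        rw [hx₃, add_comm, res8_add_of_eq (neg_ne_zero.mpr hn0) (k := k) hk.2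
          (by rw [hvnn, ← hv]; exact_mod_cast hk.1), hrnn]
      rw [hr₁, hr₃] at hprod
      rw [parityBit_eq_one_of_odd (by rw [hv₁]; exact odd_one), parityBit_eq_zero_of_even heven,
        mul_zero, add_zero, chi4, ← hr]
      -- `k = v - 1` is odd: `k = 1` or `k ≥ 3`
      have hkodd : k = 1 ∨ 3 ≤ k := by obtain ⟨j, hj⟩ := heven; omega
      rcases hkodd with rfl | hk3
      · rw [pow_one] at hprod
        exact (aux_D1 r s hrr hss hprod).symm ▸ rfl
      · have h2k : (2 : ZMod (2 ^ 3)) ^ k = 0 := by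
          obtain ⟨j, rfl⟩ := Nat.exists_eq_add_of_le hk3
          rw [pow_add, show (2 : ZMod (2 ^ 3)) ^ 3 = 0 from rfl, zero_mul]
        rw [h2k, zero_mul, add_zero, add_zero] at hprod
        exact (aux_D2 r s hrr hss hprod).symm ▸ rfl

end Two

end Literature.NumberTheory.EllipticCurves.TwoDescentLocal

end
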